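import Summits.QuantumFields.BalabanUV.Beta.GAN24.CombesThomas
import Summits.QuantumFields.BalabanUV.Beta.BorderedHessianStep
import Summits.QuantumFields.BalabanUV.Beta.GAN24.FineReadoutCauchyReal

/-!
# `BalabanUV.Beta.GAN24.CrossedLedgerCellScalar` — binder row G-an2-4 ∕ (CONV-C), W-slot (α-0), ROW (C)sym AT LEVELS `≥ 1`, register PART VI row **T6-VAL**
# (sub-row «T6-VAL∕cell-law»): **THE SCALAR HALF OF THE CELL LAW HOLDS** — the prefactor of leaf-06 g55's displayed crossed CELL value of the level-`(j+1)` forcing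
# (`ForcingCellPairFormSucc.crossed_zmode_forcing_succ`: `2·(c·(−κ²·Lc²))·(|box Lc|·(Lc·sm·sf·κ′)²·K_E²·(−½)(½)·sf²·wVH_{j+1}⁻¹·(Π₁ + Π₂))`) IS EXACTLY `Lc^{d+1}∕2` times
# `4 × ` leaf-06 g57's E⊗E face prefactor at level `j+1` (`DepthTowerPrefactors.eePrefactor_closed`) — equivalently `Lc^{d+1}∕2 × 4 × Lc^{2(d+1)} ×` the level-`j` prefactor
# (the DEEPER term's): the cell law `X(zmode_Lc b̃_{j+1})(a,b) = (Lc^{d+1}∕2)·G (j+1) 0 a b` of `CrossedLedgerCellLaw` ∕ `CrossedLedgerForcingCell` reduces to the statement that the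
# cell's Green's-function pairings `Π₁, Π₂` ARE the face word's deeper pairings at fine period `Lc` — no number left in it
# (G-an2-4 CRUX TEAM (2), leaf prover 03 `b2b-balaban-gan24-formalise-leaf-03`, gen 73; journal [LEAF03-G73-INTENT3])

NOT IN PRINT; OUR BOOKKEEPING ([folklore] `field_simp` ∕ `ring` over the step units' closed forms (sfStep = t, smStep = t^{d+1}, stepScale = t^{d+2}, wVH = t^{2(d+2)}, wE = t^{3(d+2)},
t = Lc^j — the content of leaf-06 g57's `DepthTowerPrefactors.units_eq` ✓ p384015, used as local `have`s by `rfl` ∕ `pow_mul` because that module's hub olean is not yet built;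
nothing of it restated as a declaration) and `FineReadoutCauchyReal.card_box_eq` (`|box Lc| = Lc^{d+1}`); imports `CombesThomas` ✓, `BorderedHessianStep` ✓,
`FineReadoutCauchyReal` ✓ only; 0 `def`, 0 cited fact, 0 `def … : Prop`, 0 sorry).
HONEST FRAMING (cell contract, verbatim): «discharging `BetaPertH` makes Bałaban's UV stability UNCONDITIONAL — a real constructive-QFT result; it is NOT the continuum
limit and NOT the Clay problem.»  HONEST DEPENDENCY (verbatim): «continuum YM on T⁴ ⇐ BetaPertH ∧ nine spine estimates (0/9 proved); BetaPertH ⇐ (D1) ∧ (D4) ∧ CAP+tail;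
G-an2-4 gates asym, D1 and NE2/3/4.»

v2 (gen 74, APPEND-ONLY — §1–§3 byte-identical to v1 74e63da781d67c6e ✓ p385234): + §4 `cell_crossed_closed` ∕ `pin_cell_crossed` ∕ `pin_cell_crossed_potential` — the same
scalar identity with the display's two pairings as FREE LETTERS and the left side in the display's own term structure, so that road-P2's END FILE closes its `hcell` binder by
`exact hg.trans (pin_cell_crossed hcE₂ _ _ i)` (junction-checked at the default heartbeat budget, journal [LEAF03-G74-CERT-1]); the cell twin of leaf-06 g58's
`FaceReadCrossedValueDeepPin`.

WHY.  `CrossedLedgerCellLaw` (gen 73): after leaf-06 g57's Wilson number, the crossed ledger `hXu` IS the cell law `Xc (j+1) = γ·G (j+1) 0`, `γ = Lc^{d+1}∕2` (`Lc⁴∕2` at `d = 3`),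
`G (j+1) 0` = the DEEPER term of the level-`j` crossed face value at the lowest face period.  Both sides are DISPLAYED by the (γ) hand: the cell value by leaf-06 g55's
`ForcingCellPairFormSucc.crossed_zmode_forcing_succ` (staged) as an explicit scalar times the two-pattern sum `Π_j(b,a;a,b) + Π_j(a,b;b,a)` of ONE Green's-function pairing
`⟨q^{(Lc)}, E2_{j+1} q^{(Lc)}⟩_{box Lc}`; the face value by leaf-06 g57's `FaceReadCrossedValueZero` (level `0`, staged) ∕ g56's deep chain (levels `≥ 1`) as `4·P(j)·((LEAD₁ + LEAD₂)
− Lc^{2(d+1)}·(DEEP₁ + DEEP₂))` with `P(j)` the E⊗E prefactor of `DepthTowerPrefactors` (✓ p384015; `P(j+1) = Lc^{2(d+1)}·P(j)`), whose DEEP pairings at coarse period `P 0 = Lc` are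
pairings of the same kind `⟨q^{(Lc)}, E2_{j+1} q^{(Lc)}⟩_{box Lc}` on the same two patterns.  THIS FILE checks the SCALARS: g55's cell prefactor, in closed form, equals
`(Lc^{d+1}∕2)·4·P(j+1)` EXACTLY (every `d`, every `j`, generic quartic scalar `c`; the E amplitude pinned `cE = Lc^{d+1}` as in g55's display).  So the cell law holds as soon as
the cell's pairings and the face word's deeper pairings at period `Lc` are identified term by term (leaf-06's K7 letters: J2 ∕ gen-53 `ExchangeESectorValue` ∕ g56 `FaceWordEECellOne`)
— leaf-06 g57's READING «`γ = Lc^{d+1}∕2`» (`K7-ZERO-g57.md` §3) as a kernel identity on the displayed scalars.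

WHAT ([folklore]; `sf := sfStep Lc (j+1)`, `sm := smStep d Lc (j+1)`, `κ := sf·sm·((Lc^{j+2})^{d+2})⁻¹`, `κ′ := ((Lc^{j+2})^{d+2})⁻¹`, `K_E := (sf·sm)⁻¹·sf⁻²·(Lc^{d+1}·wE_{j+1})`
— the letters of g55's display VERBATIM; `X₁ X₂ : ℝ` stand for the two pairings):
* §1 **`cellScalar_apply`** — pure algebra: g55's display, read as a function of `(X₁, X₂)`, is ONE scalar times `(X₁ + X₂)`;
* §2 **`cellScalar_closed`** — that scalar is `(c∕2)·(Lc^{j+1})^{2(d+1)}∕Lc^{d+1}` ... stated as `(c·(Lc^{d+1})²∕2)·(Lc^{j+1})^{2(d+1)}∕(Lc^{d+1})³`;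
* §3 **`cellScalar_eq_gamma_facePrefactor`** — `= (Lc^{d+1}∕2)·(4·P(j+1))` with `P(j+1)` written as `DepthTowerPrefactors.eePrefactor_closed`'s LEFT side at level `j+1`, `cE := Lc^{d+1}`
  (so a consumer holding the face display rewrites by name); **`cellScalar_eq_gamma_facePrefactor_deep`** — `= (Lc^{d+1}∕2)·(4·(P(j)·(Lc^{d+1}·Lc^{d+1})))`, the DEEPER-term form
  (the factor `Lc^{d+1}·Lc^{d+1}` as printed in the face displays).
Asserts NO value of Bałaban's tables (scalars of DISPLAYED identities only; the pairings are free letters `X₁ X₂`); discharges NOTHING of `hX` ∕ `hXu` ∕ (C)_{≥1} ∕ `hB0` ∕ `hBF` ∕ (Q-L);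
NEVER «G-an2-4 closed» as (CONV-C); NOT D1, NOT `BetaPertH`, NOT continuum, NOT Clay.  2026-08-24; no existing file touched.
-/

noncomputable section

open Literature.MathematicalPhysics.QuantumFieldTheory.Balaban1983to89.Beta
open BalabanStepJetsSucc (wE wVH)
open AffineAveraging (box)
open Summit.QuantumFields.BalabanUV.Beta.BorderedHessian (stepScale)
open Summit.QuantumFields.BalabanUV.Beta.GAN24.CombesThomas (sfStep smStep)
open Summit.QuantumFields.BalabanUV.Beta.GAN24.FineReadoutCauchyReal (card_box_eq)

namespace Summit.QuantumFields.BalabanUV.Beta.GAN24.CrossedLedgerCellScalar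

variable {d : ℕ} {Lc : ℕ} [NeZero Lc]

/-! ## §1 Pure algebra: g55's display is one scalar times the two-pattern sum -/

omit [NeZero Lc] in
/-- [folklore] **g55's DISPLAYED CELL VALUE AS A FUNCTION OF ITS TWO PAIRINGS** (any reals `sf sm c L w e κ′ card X₁ X₂`; the term structure of
`ForcingCellPairFormSucc.crossed_zmode_forcing_succ`'s right side with `Π₁ ↦ X₁`, `Π₂ ↦ X₂`): it is ONE scalar times `(X₁ + X₂)`. -/
theorem cellScalar_apply (sf sm c L w e κ' card X₁ X₂ : ℝ) :
    2 * (c * (-((sf * sm * κ') * (sf * sm * κ')) * (L * L))) *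
        (card * ((L * (sm * sf)) * κ') ^ 2 * ((((sf * sm)⁻¹ * (sf⁻¹ * sf⁻¹) * e) * (-(1 / 2 : ℝ))) * (((sf * sm)⁻¹ * (sf⁻¹ * sf⁻¹) * e) * (1 / 2 : ℝ)) * ((sf * sf) * (w⁻¹ * X₁)))
          + card * ((L * (sm * sf)) * κ') ^ 2 * ((((sf * sm)⁻¹ * (sf⁻¹ * sf⁻¹) * e) * (-(1 / 2 : ℝ))) * (((sf * sm)⁻¹ * (sf⁻¹ * sf⁻¹) * e) * (1 / 2 : ℝ)) * ((sf * sf) * (w⁻¹ * X₂))))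
      = (2 * (c * (-((sf * sm * κ') * (sf * sm * κ')) * (L * L))) * (card * ((L * (sm * sf)) * κ') ^ 2 *
          ((((sf * sm)⁻¹ * (sf⁻¹ * sf⁻¹) * e) * (-(1 / 2 : ℝ))) * (((sf * sm)⁻¹ * (sf⁻¹ * sf⁻¹) * e) * (1 / 2 : ℝ)) * ((sf * sf) * w⁻¹)))) * (X₁ + X₂) := by
  ring

/-! ## §2 The cell scalar in closed form (step units at level `j+1`, E amplitude `Lc^{d+1}`) -/

/-- NOT IN PRINT; OUR BOOKKEEPING.  **g55's CELL PREFACTOR IN CLOSED FORM**: with the level-`(j+1)` units `sf = sfStep Lc (j+1) = Lc^{j+1}`, `sm = smStep d Lc (j+1)`,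
`κ′ = ((Lc^{j+2})^{d+2})⁻¹`, `wVH_{j+1}`, `wE_{j+1}` and `|box Lc| = Lc^{d+1}`, the scalar of `cellScalar_apply` equals `(c·(Lc^{d+1})²∕2)·(Lc^{j+1})^{2(d+1)}∕(Lc^{d+1})³`. -/
theorem cellScalar_closed (c : ℝ) (j : ℕ) :
    2 * (c * (-((sfStep Lc (j + 1) * smStep d Lc (j + 1) * ((((Lc ^ (j + 1 + 1) : ℕ) : ℝ)) ^ (d + 1 + 1))⁻¹) *
          (sfStep Lc (j + 1) * smStep d Lc (j + 1) * ((((Lc ^ (j + 1 + 1) : ℕ) : ℝ)) ^ (d + 1 + 1))⁻¹)) * ((Lc : ℝ) * (Lc : ℝ)))) *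
        (((box (d + 1) Lc).card : ℝ) * (((Lc : ℝ) * (smStep d Lc (j + 1) * sfStep Lc (j + 1))) * ((((Lc ^ (j + 1 + 1) : ℕ) : ℝ)) ^ (d + 1 + 1))⁻¹) ^ 2 *
          ((((sfStep Lc (j + 1) * smStep d Lc (j + 1))⁻¹ * ((sfStep Lc (j + 1))⁻¹ * (sfStep Lc (j + 1))⁻¹) * ((Lc : ℝ) ^ (d + 1) * wE d Lc (j + 1))) * (-(1 / 2 : ℝ))) *
            (((sfStep Lc (j + 1) * smStep d Lc (j + 1))⁻¹ * ((sfStep Lc (j + 1))⁻¹ * (sfStep Lc (j + 1))⁻¹) * ((Lc : ℝ) ^ (d + 1) * wE d Lc (j + 1))) * (1 / 2 : ℝ)) *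
            ((sfStep Lc (j + 1) * sfStep Lc (j + 1)) * (wVH d Lc (j + 1))⁻¹)))
      = (c * ((Lc : ℝ) ^ (d + 1)) ^ 2 / 2) * ((((Lc : ℝ) ^ (j + 1)) ^ (2 * (d + 1))) / ((Lc : ℝ) ^ (d + 1)) ^ 3) := by
  have h1 : sfStep Lc (j + 1) = (Lc : ℝ) ^ (j + 1) := rfl
  have h2 : smStep d Lc (j + 1) = ((Lc : ℝ) ^ (j + 1)) ^ (d + 1) := by unfold CombesThomas.smStep; rw [pow_mul]
  have h3 : stepScale d Lc (j + 1) = ((Lc : ℝ) ^ (j + 1)) ^ (d + 2) := rfl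
  have h4 : wVH d Lc (j + 1) = ((Lc : ℝ) ^ (j + 1)) ^ (2 * (d + 2)) := rfl
  have h5 : wE d Lc (j + 1) = ((Lc : ℝ) ^ (j + 1)) ^ (3 * (d + 2)) := rfl
  rw [h1, h2, h4, h5, card_box_eq]
  have hL : (Lc : ℝ) ≠ 0 := Nat.cast_ne_zero.mpr (NeZero.ne Lc)
  have ht : ((Lc : ℝ) ^ (j + 1)) ≠ 0 := pow_ne_zero _ hL
  have hu : ((Lc : ℝ) ^ (d + 1)) ≠ 0 := pow_ne_zero _ hL
  push_cast
  field_simp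
  ring

/-! ## §3 The cell scalar IS `γ × 4 ×` the face prefactor, `γ = Lc^{d+1}∕2` -/

/-- NOT IN PRINT; OUR BOOKKEEPING.  **THE SCALAR HALF OF THE CELL LAW**: g55's cell prefactor at level `j+1` equals `(Lc^{d+1}∕2)·(4·P(j+1))`, `P(j+1)` = leaf-06 g57's E⊗E
face prefactor at level `j+1` — written here as `DepthTowerPrefactors.eePrefactor_closed`'s LEFT side with the E amplitude `cE := Lc^{d+1}` (rewrite by that name on the face side).
So the cell law `X(zmode_Lc b̃_{j+1})(a,b) = (Lc^{d+1}∕2)·G (j+1) 0 a b` holds with `G (j+1) 0 := 4·P(j+1)·(Π₁ + Π₂)` as soon as the cell's two pairings `Π₁, Π₂` are the face word's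
DEEPER pairings at fine period `Lc` (leaf-06's letters) — `γ = Lc^{d+1}∕2` (leaf-06 g57's reading, `K7-ZERO-g57.md` §3) is a kernel identity. -/
theorem cellScalar_eq_gamma_facePrefactor (c : ℝ) (j : ℕ) :
    2 * (c * (-((sfStep Lc (j + 1) * smStep d Lc (j + 1) * ((((Lc ^ (j + 1 + 1) : ℕ) : ℝ)) ^ (d + 1 + 1))⁻¹) *
          (sfStep Lc (j + 1) * smStep d Lc (j + 1) * ((((Lc ^ (j + 1 + 1) : ℕ) : ℝ)) ^ (d + 1 + 1))⁻¹)) * ((Lc : ℝ) * (Lc : ℝ)))) *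
        (((box (d + 1) Lc).card : ℝ) * (((Lc : ℝ) * (smStep d Lc (j + 1) * sfStep Lc (j + 1))) * ((((Lc ^ (j + 1 + 1) : ℕ) : ℝ)) ^ (d + 1 + 1))⁻¹) ^ 2 *
          ((((sfStep Lc (j + 1) * smStep d Lc (j + 1))⁻¹ * ((sfStep Lc (j + 1))⁻¹ * (sfStep Lc (j + 1))⁻¹) * ((Lc : ℝ) ^ (d + 1) * wE d Lc (j + 1))) * (-(1 / 2 : ℝ))) *
            (((sfStep Lc (j + 1) * smStep d Lc (j + 1))⁻¹ * ((sfStep Lc (j + 1))⁻¹ * (sfStep Lc (j + 1))⁻¹) * ((Lc : ℝ) ^ (d + 1) * wE d Lc (j + 1))) * (1 / 2 : ℝ)) *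
            ((sfStep Lc (j + 1) * sfStep Lc (j + 1)) * (wVH d Lc (j + 1))⁻¹)))
      = ((Lc : ℝ) ^ (d + 1) / 2) * (4 *
          ((c * -(((sfStep Lc (j + 1) * smStep d Lc (j + 1)) * (stepScale d Lc (j + 1) * (Lc : ℝ) ^ (d + 1))⁻¹) *
              ((sfStep Lc (j + 1) * smStep d Lc (j + 1)) * (stepScale d Lc (j + 1) * (Lc : ℝ) ^ (d + 1))⁻¹))) *
            ((((sfStep Lc (j + 1) * smStep d Lc (j + 1)) * (stepScale d Lc (j + 1) * (Lc : ℝ) ^ (d + 1))⁻¹) *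
                ((sfStep Lc (j + 1) * smStep d Lc (j + 1)) * (stepScale d Lc (j + 1) * (Lc : ℝ) ^ (d + 1))⁻¹)) *
              ((((sfStep Lc (j + 1) * smStep d Lc (j + 1))⁻¹ * ((sfStep Lc (j + 1))⁻¹ * (sfStep Lc (j + 1))⁻¹) * ((Lc : ℝ) ^ (d + 1) * wE d Lc (j + 1))) *
                  ((sfStep Lc (j + 1) * smStep d Lc (j + 1))⁻¹ * ((sfStep Lc (j + 1))⁻¹ * (sfStep Lc (j + 1))⁻¹) * ((Lc : ℝ) ^ (d + 1) * wE d Lc (j + 1)))) *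
                ((-(1 / 2 : ℝ)) * (1 / 2 : ℝ) * ((sfStep Lc (j + 1) * sfStep Lc (j + 1)) * (wVH d Lc (j + 1))⁻¹)))))) := by
  have h1 : sfStep Lc (j + 1) = (Lc : ℝ) ^ (j + 1) := rfl
  have h2 : smStep d Lc (j + 1) = ((Lc : ℝ) ^ (j + 1)) ^ (d + 1) := by unfold CombesThomas.smStep; rw [pow_mul]
  have h3 : stepScale d Lc (j + 1) = ((Lc : ℝ) ^ (j + 1)) ^ (d + 2) := rfl
  have h4 : wVH d Lc (j + 1) = ((Lc : ℝ) ^ (j + 1)) ^ (2 * (d + 2)) := rfl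
  have h5 : wE d Lc (j + 1) = ((Lc : ℝ) ^ (j + 1)) ^ (3 * (d + 2)) := rfl
  rw [h1, h2, h3, h4, h5, card_box_eq]
  have hL : (Lc : ℝ) ≠ 0 := Nat.cast_ne_zero.mpr (NeZero.ne Lc)
  have ht : ((Lc : ℝ) ^ (j + 1)) ≠ 0 := pow_ne_zero _ hL
  have hu : ((Lc : ℝ) ^ (d + 1)) ≠ 0 := pow_ne_zero _ hL
  push_cast
  field_simp
  ring

/-- NOT IN PRINT; OUR BOOKKEEPING.  **THE SAME THROUGH THE DEEPER TERM OF LEVEL `j`**: g55's cell prefactor at level `j+1` equals `(Lc^{d+1}∕2)·(4·(P(j)·(Lc^{d+1}·Lc^{d+1})))` —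
`P(j)` = `DepthTowerPrefactors.eePrefactor_closed`'s left side at level `j` (`cE := Lc^{d+1}`), `Lc^{d+1}·Lc^{d+1}` the deeper term's factor as printed in the face displays
(`FaceReadCrossedValueZero` ∕ `FaceWordEEValueDeep`).  With `DepthTowerPrefactors.eePrefactor_succ` this is `cellScalar_eq_gamma_facePrefactor`. -/
theorem cellScalar_eq_gamma_facePrefactor_deep (c : ℝ) (j : ℕ) :
    2 * (c * (-((sfStep Lc (j + 1) * smStep d Lc (j + 1) * ((((Lc ^ (j + 1 + 1) : ℕ) : ℝ)) ^ (d + 1 + 1))⁻¹) *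
          (sfStep Lc (j + 1) * smStep d Lc (j + 1) * ((((Lc ^ (j + 1 + 1) : ℕ) : ℝ)) ^ (d + 1 + 1))⁻¹)) * ((Lc : ℝ) * (Lc : ℝ)))) *
        (((box (d + 1) Lc).card : ℝ) * (((Lc : ℝ) * (smStep d Lc (j + 1) * sfStep Lc (j + 1))) * ((((Lc ^ (j + 1 + 1) : ℕ) : ℝ)) ^ (d + 1 + 1))⁻¹) ^ 2 *
          ((((sfStep Lc (j + 1) * smStep d Lc (j + 1))⁻¹ * ((sfStep Lc (j + 1))⁻¹ * (sfStep Lc (j + 1))⁻¹) * ((Lc : ℝ) ^ (d + 1) * wE d Lc (j + 1))) * (-(1 / 2 : ℝ))) *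
            (((sfStep Lc (j + 1) * smStep d Lc (j + 1))⁻¹ * ((sfStep Lc (j + 1))⁻¹ * (sfStep Lc (j + 1))⁻¹) * ((Lc : ℝ) ^ (d + 1) * wE d Lc (j + 1))) * (1 / 2 : ℝ)) *
            ((sfStep Lc (j + 1) * sfStep Lc (j + 1)) * (wVH d Lc (j + 1))⁻¹)))
      = ((Lc : ℝ) ^ (d + 1) / 2) * (4 *
          (((c * -(((sfStep Lc j * smStep d Lc j) * (stepScale d Lc j * (Lc : ℝ) ^ (d + 1))⁻¹) *
              ((sfStep Lc j * smStep d Lc j) * (stepScale d Lc j * (Lc : ℝ) ^ (d + 1))⁻¹))) *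
            ((((sfStep Lc j * smStep d Lc j) * (stepScale d Lc j * (Lc : ℝ) ^ (d + 1))⁻¹) *
                ((sfStep Lc j * smStep d Lc j) * (stepScale d Lc j * (Lc : ℝ) ^ (d + 1))⁻¹)) *
              ((((sfStep Lc j * smStep d Lc j)⁻¹ * ((sfStep Lc j)⁻¹ * (sfStep Lc j)⁻¹) * ((Lc : ℝ) ^ (d + 1) * wE d Lc j)) *
                  ((sfStep Lc j * smStep d Lc j)⁻¹ * ((sfStep Lc j)⁻¹ * (sfStep Lc j)⁻¹) * ((Lc : ℝ) ^ (d + 1) * wE d Lc j))) *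
                ((-(1 / 2 : ℝ)) * (1 / 2 : ℝ) * ((sfStep Lc j * sfStep Lc j) * (wVH d Lc j)⁻¹))))) *
            ((Lc : ℝ) ^ (d + 1) * (Lc : ℝ) ^ (d + 1)))) := by
  have h1 : sfStep Lc (j + 1) = (Lc : ℝ) ^ (j + 1) := rfl
  have h2 : smStep d Lc (j + 1) = ((Lc : ℝ) ^ (j + 1)) ^ (d + 1) := by unfold CombesThomas.smStep; rw [pow_mul]
  have h3 : stepScale d Lc (j + 1) = ((Lc : ℝ) ^ (j + 1)) ^ (d + 2) := rfl
  have h4 : wVH d Lc (j + 1) = ((Lc : ℝ) ^ (j + 1)) ^ (2 * (d + 2)) := rfl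
  have h5 : wE d Lc (j + 1) = ((Lc : ℝ) ^ (j + 1)) ^ (3 * (d + 2)) := rfl
  have g1 : sfStep Lc j = (Lc : ℝ) ^ j := rfl
  have g2 : smStep d Lc j = ((Lc : ℝ) ^ j) ^ (d + 1) := by unfold CombesThomas.smStep; rw [pow_mul]
  have g3 : stepScale d Lc j = ((Lc : ℝ) ^ j) ^ (d + 2) := rfl
  have g4 : wVH d Lc j = ((Lc : ℝ) ^ j) ^ (2 * (d + 2)) := rfl
  have g5 : wE d Lc j = ((Lc : ℝ) ^ j) ^ (3 * (d + 2)) := rfl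
  rw [h1, h2, h4, h5, g1, g2, g3, g4, g5, card_box_eq]
  have hL : (Lc : ℝ) ≠ 0 := Nat.cast_ne_zero.mpr (NeZero.ne Lc)
  have ht : ((Lc : ℝ) ^ (j + 1)) ≠ 0 := pow_ne_zero _ hL
  have ht' : ((Lc : ℝ) ^ j) ≠ 0 := pow_ne_zero _ hL
  have hu : ((Lc : ℝ) ^ (d + 1)) ≠ 0 := pow_ne_zero _ hL
  push_cast
  field_simp
  ring

/-! ## §4 AT THE PINS, WITH THE TWO PAIRINGS AS FREE LETTERS (gen 74; the cell twin of leaf-06 g58's `FaceReadCrossedValueDeepPin`)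

WHY.  Road-P2 g51's END FILE `WrecAtEvenHalfRowsOfTowerEnd` (INTENT 6, journal [GAN24P2-G51-ENDFILE]) discharges its `hcell` binder from leaf-06 g55's cell display
`ForcingCellPairFormSucc.crossed_zmode_forcing_succ_lit` by `refine hg.trans ?_` ⨾ a local `hS` (`cellScalar_closed` ⨾ `field_simp` ⨾ `ring`) ⨾ `linear_combination (Π₁ + Π₂) * hS`
with `Π₁`, `Π₂` the two ≈ 750-character pairing sums written out — under `set_option maxHeartbeats 4000000`.  The three theorems below state that step ONCE with the pairings as letters
`X₁ X₂ : ℝ`, the left side in the display's OWN term structure (g55's right side VERBATIM, each pairing sum replaced by its letter), so that the END FILE's block is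
`exact hg.trans (pin_cell_crossed hcE₂ _ _ i)` (first-order unification assigns the two sums to `X₁`, `X₂`).  Nothing of g55's display is asserted here. -/

/-- NOT IN PRINT; OUR BOOKKEEPING.  **g55's CELL DISPLAY WITH FREE PAIRINGS, IN CLOSED FORM** (every `d`, every `j`, free quartic scalar `c`, free pairings `X₁ X₂`): the right
side of `ForcingCellPairFormSucc.crossed_zmode_forcing_succ_lit` (its term structure verbatim, generic `d`, `c` for the forcing scale, the two pairing sums replaced by
`X₁`, `X₂`) equals `(c·(Lc^{d+1})²∕2)·((Lc^{j+1})^{2(d+1)}∕(Lc^{d+1})³)·(X₁ + X₂)` — `cellScalar_closed` times the two-pattern sum. -/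
theorem cell_crossed_closed (c X₁ X₂ : ℝ) (j : ℕ) :
    2 * (c * (-(((sfStep Lc (j + 1)) * (smStep d Lc (j + 1)) * ((((Lc ^ (j + 1 + 1) : ℕ) : ℝ)) ^ (d + 1 + 1))⁻¹) * ((sfStep Lc (j + 1)) * (smStep d Lc (j + 1)) * ((((Lc ^ (j + 1 + 1) : ℕ) : ℝ)) ^ (d + 1 + 1))⁻¹)) * ((Lc : ℝ) * (Lc : ℝ))) *
          (((box (d + 1) Lc).card : ℝ) * (((Lc : ℝ) * ((smStep d Lc (j + 1)) * (sfStep Lc (j + 1)))) * ((((Lc ^ (j + 1 + 1) : ℕ) : ℝ)) ^ (d + 1 + 1))⁻¹) ^ 2 *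
          (((((sfStep Lc (j + 1)) * (smStep d Lc (j + 1)))⁻¹ * ((sfStep Lc (j + 1))⁻¹ * (sfStep Lc (j + 1))⁻¹) * ((Lc : ℝ) ^ (d + 1) * wE d Lc (j + 1))) * (-(1 / 2 : ℝ))) * ((((sfStep Lc (j + 1)) * (smStep d Lc (j + 1)))⁻¹ * ((sfStep Lc (j + 1))⁻¹ * (sfStep Lc (j + 1))⁻¹) * ((Lc : ℝ) ^ (d + 1) * wE d Lc (j + 1))) * (1 / 2 : ℝ)) *
            (((sfStep Lc (j + 1)) * (sfStep Lc (j + 1))) * ((wVH d Lc (j + 1))⁻¹ *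
              X₁)))
          + ((box (d + 1) Lc).card : ℝ) * (((Lc : ℝ) * ((smStep d Lc (j + 1)) * (sfStep Lc (j + 1)))) * ((((Lc ^ (j + 1 + 1) : ℕ) : ℝ)) ^ (d + 1 + 1))⁻¹) ^ 2 *
          (((((sfStep Lc (j + 1)) * (smStep d Lc (j + 1)))⁻¹ * ((sfStep Lc (j + 1))⁻¹ * (sfStep Lc (j + 1))⁻¹) * ((Lc : ℝ) ^ (d + 1) * wE d Lc (j + 1))) * (-(1 / 2 : ℝ))) * ((((sfStep Lc (j + 1)) * (smStep d Lc (j + 1)))⁻¹ * ((sfStep Lc (j + 1))⁻¹ * (sfStep Lc (j + 1))⁻¹) * ((Lc : ℝ) ^ (d + 1) * wE d Lc (j + 1))) * (1 / 2 : ℝ)) *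
            (((sfStep Lc (j + 1)) * (sfStep Lc (j + 1))) * ((wVH d Lc (j + 1))⁻¹ *
              X₂)))))
      = (c * ((Lc : ℝ) ^ (d + 1)) ^ 2 / 2) * ((((Lc : ℝ) ^ (j + 1)) ^ (2 * (d + 1))) / ((Lc : ℝ) ^ (d + 1)) ^ 3) * (X₁ + X₂) := by
  linear_combination (X₁ + X₂) * cellScalar_closed (d := d) (Lc := Lc) c j

/-- NOT IN PRINT; OUR BOOKKEEPING.  **THE CELL VALUE AT THE PINS** (`d = 3`, forcing scale `cE₂·Lc^{2(3+1)}` with `cE₂ = Lc^{2(3+1)}`; every `j`, free pairings): g55's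
displayed right side at level `j+1` equals `(Lc⁴∕2)·(Lc^{8+8(j+1)}·(X₁ + X₂))` — the right side of road-P2 g51's END-FILE binder `hcell` (`γ = Lc⁴∕2`, `G (j+1) 0 a b =
Lc^{8+8(j+1)}·PAIRSUM_{j+1}(P 0)(a,b)` after `rw [hP0]`) LETTER FOR LETTER, with `PAIRSUM = X₁ + X₂`.  USE (road-P2): `exact hg.trans (pin_cell_crossed hcE₂ _ _ i)`. -/
theorem pin_cell_crossed {cE₂ : ℝ} (hcE₂ : cE₂ = (Lc : ℝ) ^ (2 * (3 + 1))) (X₁ X₂ : ℝ) (j : ℕ) :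
    2 * ((cE₂ * (Lc : ℝ) ^ (2 * (3 + 1))) * (-(((sfStep Lc (j + 1)) * (smStep 3 Lc (j + 1)) * ((((Lc ^ (j + 1 + 1) : ℕ) : ℝ)) ^ (3 + 1 + 1))⁻¹) * ((sfStep Lc (j + 1)) * (smStep 3 Lc (j + 1)) * ((((Lc ^ (j + 1 + 1) : ℕ) : ℝ)) ^ (3 + 1 + 1))⁻¹)) * ((Lc : ℝ) * (Lc : ℝ))) *
          (((box (3 + 1) Lc).card : ℝ) * (((Lc : ℝ) * ((smStep 3 Lc (j + 1)) * (sfStep Lc (j + 1)))) * ((((Lc ^ (j + 1 + 1) : ℕ) : ℝ)) ^ (3 + 1 + 1))⁻¹) ^ 2 *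
          (((((sfStep Lc (j + 1)) * (smStep 3 Lc (j + 1)))⁻¹ * ((sfStep Lc (j + 1))⁻¹ * (sfStep Lc (j + 1))⁻¹) * ((Lc : ℝ) ^ (3 + 1) * wE 3 Lc (j + 1))) * (-(1 / 2 : ℝ))) * ((((sfStep Lc (j + 1)) * (smStep 3 Lc (j + 1)))⁻¹ * ((sfStep Lc (j + 1))⁻¹ * (sfStep Lc (j + 1))⁻¹) * ((Lc : ℝ) ^ (3 + 1) * wE 3 Lc (j + 1))) * (1 / 2 : ℝ)) *
            (((sfStep Lc (j + 1)) * (sfStep Lc (j + 1))) * ((wVH 3 Lc (j + 1))⁻¹ *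
              X₁)))
          + ((box (3 + 1) Lc).card : ℝ) * (((Lc : ℝ) * ((smStep 3 Lc (j + 1)) * (sfStep Lc (j + 1)))) * ((((Lc ^ (j + 1 + 1) : ℕ) : ℝ)) ^ (3 + 1 + 1))⁻¹) ^ 2 *
          (((((sfStep Lc (j + 1)) * (smStep 3 Lc (j + 1)))⁻¹ * ((sfStep Lc (j + 1))⁻¹ * (sfStep Lc (j + 1))⁻¹) * ((Lc : ℝ) ^ (3 + 1) * wE 3 Lc (j + 1))) * (-(1 / 2 : ℝ))) * ((((sfStep Lc (j + 1)) * (smStep 3 Lc (j + 1)))⁻¹ * ((sfStep Lc (j + 1))⁻¹ * (sfStep Lc (j + 1))⁻¹) * ((Lc : ℝ) ^ (3 + 1) * wE 3 Lc (j + 1))) * (1 / 2 : ℝ)) *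
            (((sfStep Lc (j + 1)) * (sfStep Lc (j + 1))) * ((wVH 3 Lc (j + 1))⁻¹ *
              X₂)))))
      = ((Lc : ℝ) ^ 4 / 2) * ((Lc : ℝ) ^ (8 + 8 * (j + 1)) * (X₁ + X₂)) := by
  rw [cell_crossed_closed (d := 3) (Lc := Lc) (cE₂ * (Lc : ℝ) ^ (2 * (3 + 1))) X₁ X₂ j, hcE₂]
  have hL : (Lc : ℝ) ≠ 0 := Nat.cast_ne_zero.mpr (NeZero.ne Lc)
  field_simp
  ring

/-- NOT IN PRINT; OUR BOOKKEEPING.  **THE SAME IN THE CELL-LAW LETTERS** of `CrossedLedgerCellLaw` ∕ `CrossedLedgerForcingCell` (`hcell : X(zmode_Lc b̃_{i+1})(a,b) =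
(Lc⁴∕2)·G (i+1) 0 a b`): for any real `G` with `G = Lc^{8+8(j+1)}·(X₁ + X₂)` (leaf-03 g73's instantiation map `G k n a b := 4·P(k)·PAIRSUM_k(P n)(a,b)`, `4·P(k) = Lc^{8+8k}`
at the pins, `P 0 = Lc`), g55's displayed right side is `(Lc⁴∕2)·G`. -/
theorem pin_cell_crossed_potential {cE₂ : ℝ} (hcE₂ : cE₂ = (Lc : ℝ) ^ (2 * (3 + 1))) (X₁ X₂ : ℝ) (j : ℕ)
    {G : ℝ} (hG : G = (Lc : ℝ) ^ (8 + 8 * (j + 1)) * (X₁ + X₂)) :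
    2 * ((cE₂ * (Lc : ℝ) ^ (2 * (3 + 1))) * (-(((sfStep Lc (j + 1)) * (smStep 3 Lc (j + 1)) * ((((Lc ^ (j + 1 + 1) : ℕ) : ℝ)) ^ (3 + 1 + 1))⁻¹) * ((sfStep Lc (j + 1)) * (smStep 3 Lc (j + 1)) * ((((Lc ^ (j + 1 + 1) : ℕ) : ℝ)) ^ (3 + 1 + 1))⁻¹)) * ((Lc : ℝ) * (Lc : ℝ))) *
          (((box (3 + 1) Lc).card : ℝ) * (((Lc : ℝ) * ((smStep 3 Lc (j + 1)) * (sfStep Lc (j + 1)))) * ((((Lc ^ (j + 1 + 1) : ℕ) : ℝ)) ^ (3 + 1 + 1))⁻¹) ^ 2 *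
          (((((sfStep Lc (j + 1)) * (smStep 3 Lc (j + 1)))⁻¹ * ((sfStep Lc (j + 1))⁻¹ * (sfStep Lc (j + 1))⁻¹) * ((Lc : ℝ) ^ (3 + 1) * wE 3 Lc (j + 1))) * (-(1 / 2 : ℝ))) * ((((sfStep Lc (j + 1)) * (smStep 3 Lc (j + 1)))⁻¹ * ((sfStep Lc (j + 1))⁻¹ * (sfStep Lc (j + 1))⁻¹) * ((Lc : ℝ) ^ (3 + 1) * wE 3 Lc (j + 1))) * (1 / 2 : ℝ)) *
            (((sfStep Lc (j + 1)) * (sfStep Lc (j + 1))) * ((wVH 3 Lc (j + 1))⁻¹ *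
              X₁)))
          + ((box (3 + 1) Lc).card : ℝ) * (((Lc : ℝ) * ((smStep 3 Lc (j + 1)) * (sfStep Lc (j + 1)))) * ((((Lc ^ (j + 1 + 1) : ℕ) : ℝ)) ^ (3 + 1 + 1))⁻¹) ^ 2 *
          (((((sfStep Lc (j + 1)) * (smStep 3 Lc (j + 1)))⁻¹ * ((sfStep Lc (j + 1))⁻¹ * (sfStep Lc (j + 1))⁻¹) * ((Lc : ℝ) ^ (3 + 1) * wE 3 Lc (j + 1))) * (-(1 / 2 : ℝ))) * ((((sfStep Lc (j + 1)) * (smStep 3 Lc (j + 1)))⁻¹ * ((sfStep Lc (j + 1))⁻¹ * (sfStep Lc (j + 1))⁻¹) * ((Lc : ℝ) ^ (3 + 1) * wE 3 Lc (j + 1))) * (1 / 2 : ℝ)) *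
            (((sfStep Lc (j + 1)) * (sfStep Lc (j + 1))) * ((wVH 3 Lc (j + 1))⁻¹ *
              X₂)))))
      = ((Lc : ℝ) ^ 4 / 2) * G := by
  rw [pin_cell_crossed (Lc := Lc) hcE₂ X₁ X₂ j, hG]

end Summit.QuantumFields.BalabanUV.Beta.GAN24.CrossedLedgerCellScalar

end
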